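import Summits.QuantumFields.QCD.Theorems.NestedDissectionSeaRobustYangMillsRGStubGaugeAveragingAux
import Literature.Barriers.QuantumFields.ElitzurTheorem
import Literature.MathematicalPhysics.QuantumFieldTheory.StrongCouplingActivities
import HarnessLib

/-!
# Toolkit for `stub_formatBallClustering_false` (line `birth`, crux `RobustYangMillsRG`,
# item stmt-QuantumFields-17812), part I: averaging, link maps, rough-count products

Context-free lemmas (torus `(ZMod L)^d`, compact gauge group `G`; no `SU(3)` input) behind the
negative certificate `¬ FormatBallClustering` (the realisability-free SIGNED transfer target of
idea `af-funnel` is false; certificate in `NestedDissectionSeaRobustYangMillsRGStubFormatBallClusteringFalse`):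

* the AVERAGING IDENTITY `∫ H dμ = ∫ (∫ H(Φ_a ω) dν(a)) dμ(ω)` for a family of `μ`-preserving maps
  `Φ_a` indexed by a probability space (invariance + Fubini), and `∫ 1_S(g₁ a g₂) da = Haar(S)`;
* ONE-SITE GAUGE TRANSFORMATIONS `(update 1 y a) • V` (evaluation formulas, joint measurability)
  and ONE-LINK RIGHT MULTIPLICATIONS `V ↦ V[e₀ ↦ V e₀ · a]` (joint measurability, preservation of
  the product Haar measure — registered in its `SU(3)` form as `stub_formatBallClustering_linkUpdate`);
* the ROUGH-COUNT PRODUCTS `∏_{y ∈ T} (m if y ∈ LF V else 1) = m^{#(T ∩ LF V)}` and link products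
  `∏_{y ∈ T ∩ LF V} f(V(y,1))` for an arbitrary set of sites `T` and region functional `LF`:
  positivity, monotonicity, measurability, Bernoulli's inequality `ratio^X ≥ 1 + (ratio - 1) X`,
  and the Gibbs integrals `I(m) = ∫ Ψ m^X` for a weight `0 < Ψ ≤ 1` (integrable, positive, monotone).
-/

noncomputable section

namespace Summit.QuantumFields.QCD.Cruxes.RobustYangMillsRG.Birth

open scoped BigOperators Topology Manifold Classical MeasureTheory ProbabilityTheory Matrix InnerProductSpace ComplexConjugate ContinuousMap
open Filter Set Function TopologicalSpace MeasureTheory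
open Literature.MathematicalPhysics.QuantumLattice Literature.MathematicalPhysics.AQFT
  Literature.MathematicalPhysics.QuantumFieldTheory

namespace SignedFormat

/-! ### Measure-theoretic generalities -/

section General

variable {Ω A : Type*} [MeasurableSpace Ω] [MeasurableSpace A]

/-- A measurable function bounded in absolute value is integrable for a finite measure. [folklore] -/
theorem integrable_of_abs_le {μ : Measure Ω} [IsFiniteMeasure μ] {f : Ω → ℝ}
    (hf : AEStronglyMeasurable f μ) {C : ℝ} (hC : ∀ ω, |f ω| ≤ C) : Integrable f μ :=
  Integrable.mono' (integrable_const C) hf (ae_of_all _ fun ω => by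
    simpa only [Real.norm_eq_abs] using hC ω)

/-- **Averaging identity.** If every `Φ a` preserves the finite measure `μ`, `(ω, a) ↦ Φ a ω` is
jointly measurable and `H` is bounded measurable, then `∫ H dμ = ∫ (∫ H (Φ a ω) dν(a)) dμ(ω)` for
every probability measure `ν` (invariance for each fixed `a`, then Fubini). [folklore] -/
theorem integral_eq_integral_average {μ : Measure Ω} {ν : Measure A} [IsFiniteMeasure μ]
    [IsProbabilityMeasure ν] {Φ : A → Ω → Ω} (hΦm : Measurable fun p : Ω × A => Φ p.2 p.1)
    (hΦ : ∀ a, MeasurePreserving (Φ a) μ μ) {H : Ω → ℝ} (hH : Measurable H) {C : ℝ}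
    (hC : ∀ ω, |H ω| ≤ C) :
    ∫ ω, H ω ∂μ = ∫ ω, (∫ a, H (Φ a ω) ∂ν) ∂μ := by
  have hint : Integrable (uncurry fun ω a => H (Φ a ω)) (μ.prod ν) := by
    refine Integrable.mono' (integrable_const C) ?_ (ae_of_all _ ?_)
    · exact (hH.comp hΦm).aestronglyMeasurable
    · rintro ⟨ω, a⟩
      simpa only [uncurry_apply_pair, Real.norm_eq_abs] using hC (Φ a ω)
  rw [integral_integral_swap hint]
  have h1 : ∀ a, ∫ ω, H (Φ a ω) ∂μ = ∫ ω, H ω ∂μ := fun a => by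
    have h := (hΦ a).map_eq
    calc ∫ ω, H (Φ a ω) ∂μ = ∫ ω, H ω ∂(μ.map (Φ a)) :=
          (integral_map (hΦ a).measurable.aemeasurable hH.aestronglyMeasurable).symm
      _ = ∫ ω, H ω ∂μ := by rw [h]
  simp only [h1, integral_const, probReal_univ, one_smul]

/-- The inner average `ω ↦ ∫ H (Φ a ω) dν(a)` of a bounded measurable `H` is integrable. [folklore] -/
theorem integrable_average {μ : Measure Ω} {ν : Measure A} [IsFiniteMeasure μ]
    [IsProbabilityMeasure ν] {Φ : A → Ω → Ω} (hΦm : Measurable fun p : Ω × A => Φ p.2 p.1)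
    {H : Ω → ℝ} (hH : Measurable H) {C : ℝ} (hC : ∀ ω, |H ω| ≤ C) :
    Integrable (fun ω => ∫ a, H (Φ a ω) ∂ν) μ := by
  have hsm : StronglyMeasurable fun p : Ω × A => H (Φ p.2 p.1) := (hH.comp hΦm).stronglyMeasurable
  refine integrable_of_abs_le (hsm.integral_prod_right' (ν := ν)).aestronglyMeasurable (C := C)
    fun ω => ?_
  have := norm_integral_le_of_norm_le_const (μ := ν) (f := fun a => H (Φ a ω)) (C := C)
    (ae_of_all _ fun a => by simpa only [Real.norm_eq_abs] using hC (Φ a ω))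
  simpa [Real.norm_eq_abs, probReal_univ] using this

end General

/-! ### Haar-measure identities on a compact group -/

section Haar

variable {G : Type*} [Group G] [TopologicalSpace G] [IsTopologicalGroup G] [CompactSpace G]
  [MeasurableSpace G] [BorelSpace G]

/-- `∫ 1_S(g₁ a g₂) da = Haar(S)`: two-sided translates of a measurable set have the same Haar
mass (left and right invariance of the Haar probability measure of a compact group). [folklore] -/
theorem integral_indicator_mul_mul {S : Set G} (hS : MeasurableSet S) (g₁ g₂ : G) :
    ∫ a, S.indicator (1 : G → ℝ) (g₁ * a * g₂) ∂haarProbability G = (haarProbability G).real S := by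
  have h1 : (fun a => S.indicator (1 : G → ℝ) (g₁ * a * g₂)) =
      fun a => (fun x => S.indicator (1 : G → ℝ) (g₁ * x)) (a * g₂) := by
    funext a; simp only [mul_assoc]
  rw [h1, integral_mul_right_eq_self (fun x => S.indicator (1 : G → ℝ) (g₁ * x)) g₂,
    integral_mul_left_eq_self (fun x => S.indicator (1 : G → ℝ) x) g₁]
  exact integral_indicator_one hS

/-- The mean of a function bounded by one is bounded by one. [folklore] -/
theorem abs_integral_haar_le_one {f : G → ℝ} (hf1 : ∀ u, |f u| ≤ 1) :
    |∫ u, f u ∂haarProbability G| ≤ 1 := by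
  have := norm_integral_le_of_norm_le_const (μ := haarProbability G) (f := f) (C := 1)
    (ae_of_all _ fun u => by simpa only [Real.norm_eq_abs] using hf1 u)
  simpa [Real.norm_eq_abs, probReal_univ] using this

end Haar

/-! ### One-site gauge transformations and one-link right multiplications -/

section Links

variable {d L : ℕ} {G : Type*} [Group G]

/-- Evaluation of the gauge transformation concentrated at one site. [folklore] -/
theorem gaugeTransform_update_apply (y : Site d L) (a : G) (V : GaugeConfig d L G) (e : Edge d L) :
    gaugeTransform (Function.update 1 y a) V e =
      (if e.1 = y then a else 1) * V e * (if e.1.shift e.2 = y then a else 1)⁻¹ := by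
  simp only [gaugeTransform, Function.update_apply, Pi.one_apply]

/-- At a link based at the site itself (which is not a self-neighbour) the one-site gauge
transformation multiplies on the left. [folklore] -/
theorem gaugeTransform_update_apply_base {y : Site d L} {k : Fin d} (hk : y.shift k ≠ y) (a : G)
    (V : GaugeConfig d L G) : gaugeTransform (Function.update 1 y a) V (y, k) = a * V (y, k) := by
  rw [gaugeTransform_update_apply]
  simp [hk]

/-- Links neither based at the site nor ending there are untouched. [folklore] -/
theorem gaugeTransform_update_apply_of_ne {y y' : Site d L} {k : Fin d} (h1 : y' ≠ y)
    (h2 : y'.shift k ≠ y) (a : G) (V : GaugeConfig d L G) :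
    gaugeTransform (Function.update 1 y a) V (y', k) = V (y', k) := by
  rw [gaugeTransform_update_apply]
  simp [h1, h2]

variable [MeasurableSpace G]

/-- Joint measurability of the one-link right multiplication `(V, a) ↦ V[e₀ ↦ V e₀ · a]`. [folklore] -/
theorem measurable_linkUpdate₂ [MeasurableMul₂ G] (e₀ : Edge d L) :
    Measurable fun p : GaugeConfig d L G × G => Function.update p.1 e₀ (p.1 e₀ * p.2) := by
  refine measurable_pi_lambda _ fun e => ?_
  simp only [Function.update_apply]
  by_cases h : e = e₀
  · simp only [h, if_true]
    exact ((measurable_pi_apply e₀).comp measurable_fst).mul measurable_snd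
  · simp only [h, if_false]
    exact (measurable_pi_apply e).comp measurable_fst

variable [TopologicalSpace G] [IsTopologicalGroup G] [CompactSpace G] [BorelSpace G]

/-- One-link right multiplication `V ↦ V[e₀ ↦ V e₀ · a]` preserves the product Haar measure
(right invariance of Haar on the factor `e₀`, identity elsewhere; Mathlib `measurePreserving_pi`). [folklore] -/
theorem measurePreserving_linkUpdate [NeZero L] (e₀ : Edge d L) (a : G) :
    MeasurePreserving (fun V : GaugeConfig d L G => Function.update V e₀ (V e₀ * a))
      (Measure.pi fun _ : Edge d L => haarProbability G)
      (Measure.pi fun _ : Edge d L => haarProbability G) := by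
  have hpi := measurePreserving_pi (f := fun (e : Edge d L) (x : G) => if e = e₀ then x * a else x)
    (fun _ : Edge d L => haarProbability G) (fun _ : Edge d L => haarProbability G) fun e => by
      by_cases h : e = e₀
      · simp only [h, if_true]; exact measurePreserving_mul_right (haarProbability G) a
      · simp only [h, if_false]; exact MeasurePreserving.id _
  have heq : (fun V : GaugeConfig d L G => Function.update V e₀ (V e₀ * a)) =
      fun V e => (fun (e : Edge d L) (x : G) => if e = e₀ then x * a else x) e (V e) := by
    funext V e
    simp only [Function.update_apply]
    by_cases h : e = e₀
    · subst h; simp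
    · simp [h]
  rw [heq]
  exact hpi

omit [CompactSpace G] in
/-- Joint measurability of the one-site gauge action `(V, a) ↦ (update 1 y a) • V`. [folklore] -/
theorem measurable_gaugeTransform_update₂ [SecondCountableTopology G] [NeZero L] (y : Site d L) :
    Measurable fun p : GaugeConfig d L G × G => gaugeTransform (Function.update 1 y p.2) p.1 :=
  GaugeAveraging.measurable_gaugeTransform₂.comp
    (((measurable_update (1 : Site d L → G)).comp measurable_snd).prodMk measurable_fst)

end Links

/-! ### Rough-count products `∏_{y ∈ T} (m if y ∈ LF V else 1)` and their Gibbs integrals -/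

section Products

variable {M : ℕ} {G : Type*} (T : Finset (Site 4 M)) (LF : GaugeConfig 4 M G → Finset (Site 4 M))

/-- The rough-count product as a power of the number of rough sites of `T`. [folklore] -/
theorem prod_ite_mem_eq_pow (m : ℝ) (V : GaugeConfig 4 M G) :
    ∏ y ∈ T, (if y ∈ LF V then m else 1) = m ^ (T.filter fun y => y ∈ LF V).card := by
  rw [← Finset.prod_filter, Finset.prod_const]

/-- The rough-count product is multiplicative in `m`. [folklore] -/
theorem prod_ite_mem_mul (m m' : ℝ) (V : GaugeConfig 4 M G) :
    ∏ y ∈ T, (if y ∈ LF V then m * m' else 1) =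
      (∏ y ∈ T, (if y ∈ LF V then m else 1)) * ∏ y ∈ T, (if y ∈ LF V then m' else 1) := by
  rw [← Finset.prod_mul_distrib]
  refine Finset.prod_congr rfl fun y _ => ?_
  split_ifs <;> simp

/-- The rough-count product is positive for `m > 0`. [folklore] -/
theorem prod_ite_mem_pos {m : ℝ} (hm : 0 < m) (V : GaugeConfig 4 M G) :
    0 < ∏ y ∈ T, (if y ∈ LF V then m else 1) :=
  Finset.prod_pos fun y _ => by split_ifs <;> positivity

/-- The rough-count product is nonnegative for `m ≥ 0`. [folklore] -/
theorem prod_ite_mem_nonneg {m : ℝ} (hm : 0 ≤ m) (V : GaugeConfig 4 M G) :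
    0 ≤ ∏ y ∈ T, (if y ∈ LF V then m else 1) :=
  Finset.prod_nonneg fun y _ => by split_ifs <;> positivity

/-- The rough-count product is monotone in `m ≥ 0`. [folklore] -/
theorem prod_ite_mem_mono {m m' : ℝ} (hm : 0 ≤ m) (hmm' : m ≤ m') (V : GaugeConfig 4 M G) :
    ∏ y ∈ T, (if y ∈ LF V then m else 1) ≤ ∏ y ∈ T, (if y ∈ LF V then m' else 1) := by
  refine Finset.prod_le_prod (fun y _ => by split_ifs <;> positivity) fun y _ => ?_
  split_ifs
  · exact hmm'
  · exact le_rfl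

/-- The rough-count product is at most one for `0 ≤ m ≤ 1`. [folklore] -/
theorem prod_ite_mem_le_one {m : ℝ} (hm : 0 ≤ m) (hm1 : m ≤ 1) (V : GaugeConfig 4 M G) :
    ∏ y ∈ T, (if y ∈ LF V then m else 1) ≤ 1 := by
  refine Finset.prod_le_one (fun y _ => by split_ifs <;> positivity) fun y _ => ?_
  split_ifs
  · exact hm1
  · exact le_rfl

/-- **Bernoulli for the rough count**: `ratio^{X(V)} ≥ 1 + (ratio - 1) X(V)` for `ratio ≥ 1`,
`X(V) = ∑_{y ∈ T} 1[y ∈ LF V]`. [folklore] -/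
theorem one_add_mul_sum_le_prod {r : ℝ} (hr : 1 ≤ r) (V : GaugeConfig 4 M G) :
    1 + (r - 1) * ∑ y ∈ T, (if y ∈ LF V then (1 : ℝ) else 0) ≤ ∏ y ∈ T, (if y ∈ LF V then r else 1) := by
  rw [prod_ite_mem_eq_pow]
  have hsum : ∑ y ∈ T, (if y ∈ LF V then (1 : ℝ) else 0) = ((T.filter fun y => y ∈ LF V).card : ℝ) := by
    rw [Finset.card_filter]; push_cast; rfl
  rw [hsum, mul_comm]
  have h := one_add_mul_le_pow (show (-2 : ℝ) ≤ r - 1 by linarith) (T.filter fun y => y ∈ LF V).card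
  rwa [add_sub_cancel] at h

variable {T LF}

/-- The rough-count product is measurable when the events `{y ∈ LF V}` are. [folklore] -/
theorem measurable_prod_ite_mem [MeasurableSpace G] (hLFm : ∀ y, MeasurableSet {V | y ∈ LF V}) (m : ℝ) :
    Measurable fun V => ∏ y ∈ T, (if y ∈ LF V then m else 1) :=
  Finset.measurable_prod _ fun y _ => Measurable.ite (hLFm y) measurable_const measurable_const

/-- The link product `∏_{y ∈ T ∩ LF(V)} f(V(y,1))` is measurable. [folklore] -/
theorem measurable_prod_ite_mem_apply [MeasurableSpace G] (hLFm : ∀ y, MeasurableSet {V | y ∈ LF V}) {f : G → ℝ}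
    (hf : Measurable f) : Measurable fun V => ∏ y ∈ T, (if y ∈ LF V then f (V (y, 1)) else 1) :=
  Finset.measurable_prod _ fun y _ =>
    Measurable.ite (hLFm y) (hf.comp (measurable_pi_apply _)) measurable_const

/-- `|∏_{y ∈ T ∩ LF(V)} f(V(y,1))| ≤ 1` when `|f| ≤ 1`. [folklore] -/
theorem abs_prod_ite_mem_apply_le_one {f : G → ℝ} (hf : ∀ u, |f u| ≤ 1) (V : GaugeConfig 4 M G) :
    |∏ y ∈ T, (if y ∈ LF V then f (V (y, 1)) else 1)| ≤ 1 := by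
  rw [Finset.abs_prod]
  refine Finset.prod_le_one (fun y _ => abs_nonneg _) fun y _ => ?_
  split_ifs
  · exact hf _
  · simp

/-- Powers of the link product are link products of powers. [folklore] -/
theorem prod_ite_mem_apply_pow (f : G → ℝ) (V : GaugeConfig 4 M G) (k : ℕ) :
    (∏ y ∈ T, (if y ∈ LF V then f (V (y, 1)) else 1)) ^ k =
      ∏ y ∈ T, (if y ∈ LF V then f (V (y, 1)) ^ k else 1) := by
  rw [← Finset.prod_pow]
  refine Finset.prod_congr rfl fun y _ => ?_
  split_ifs <;> simp

variable {Ψ : GaugeConfig 4 M G → ℝ}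

/-- Uniform bound `|Ψ m^X| ≤ max(1, m)^{#T}` (`0 < Ψ ≤ 1`, `m ≥ 0`). [folklore] -/
theorem abs_weight_mul_prod_le (hΨ0 : ∀ V, 0 < Ψ V) (hΨ1 : ∀ V, Ψ V ≤ 1) {m : ℝ} (hm : 0 ≤ m)
    (V : GaugeConfig 4 M G) :
    |Ψ V * ∏ y ∈ T, (if y ∈ LF V then m else 1)| ≤ max 1 m ^ T.card := by
  rw [abs_mul, abs_of_pos (hΨ0 V), abs_of_nonneg (prod_ite_mem_nonneg T LF hm V)]
  calc Ψ V * ∏ y ∈ T, (if y ∈ LF V then m else 1) ≤ 1 * ∏ y ∈ T, (if y ∈ LF V then m else 1) :=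
        mul_le_mul_of_nonneg_right (hΨ1 V) (prod_ite_mem_nonneg T LF hm V)
    _ = _ := one_mul _
    _ ≤ ∏ y ∈ T, (if y ∈ LF V then max 1 m else 1) := prod_ite_mem_mono T LF hm (le_max_right _ _) V
    _ = (max 1 m) ^ (T.filter fun y => y ∈ LF V).card := prod_ite_mem_eq_pow T LF _ V
    _ ≤ (max 1 m) ^ T.card := pow_le_pow_right₀ (le_max_left _ _) (Finset.card_filter_le _ _)

variable [NeZero M] [Group G] [MeasurableSpace G] [TopologicalSpace G] [IsTopologicalGroup G]
  [CompactSpace G] [BorelSpace G]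

/-- `Ψ m^X` is integrable. [folklore] -/
theorem integrable_weight_mul_prod (hΨm : Measurable Ψ) (hΨ0 : ∀ V, 0 < Ψ V) (hΨ1 : ∀ V, Ψ V ≤ 1)
    (hLFm : ∀ y, MeasurableSet {V | y ∈ LF V}) {m : ℝ} (hm : 0 ≤ m) :
    Integrable (fun V => Ψ V * ∏ y ∈ T, (if y ∈ LF V then m else 1))
      (Measure.pi fun _ : Edge 4 M => haarProbability G) :=
  integrable_of_abs_le (hΨm.mul (measurable_prod_ite_mem hLFm m)).aestronglyMeasurable
    (abs_weight_mul_prod_le hΨ0 hΨ1 hm)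

/-- `∫ Ψ m^X dμ > 0` for `m > 0`: the integrand is everywhere positive. [folklore] -/
theorem integral_weight_mul_prod_pos (hΨm : Measurable Ψ) (hΨ0 : ∀ V, 0 < Ψ V) (hΨ1 : ∀ V, Ψ V ≤ 1)
    (hLFm : ∀ y, MeasurableSet {V | y ∈ LF V}) {m : ℝ} (hm : 0 < m) :
    0 < ∫ V, Ψ V * ∏ y ∈ T, (if y ∈ LF V then m else 1) ∂Measure.pi fun _ : Edge 4 M => haarProbability G := by
  have hpos : ∀ V : GaugeConfig 4 M G, 0 < Ψ V * ∏ y ∈ T, (if y ∈ LF V then m else 1) := fun V =>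
    mul_pos (hΨ0 V) (prod_ite_mem_pos T LF hm V)
  refine (integral_pos_iff_support_of_nonneg (fun V => (hpos V).le)
    (integrable_weight_mul_prod hΨm hΨ0 hΨ1 hLFm hm.le)).2 ?_
  have hsupp : Function.support (fun V : GaugeConfig 4 M G => Ψ V * ∏ y ∈ T, (if y ∈ LF V then m else 1)) =
      Set.univ := Set.eq_univ_iff_forall.2 fun V => Function.mem_support.2 (hpos V).ne'
  rw [hsupp, measure_univ]
  exact one_pos

/-- Monotonicity of `m ↦ ∫ Ψ m^X dμ` on `[0, ∞)`. [folklore] -/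
theorem integral_weight_mul_prod_mono (hΨm : Measurable Ψ) (hΨ0 : ∀ V, 0 < Ψ V) (hΨ1 : ∀ V, Ψ V ≤ 1)
    (hLFm : ∀ y, MeasurableSet {V | y ∈ LF V}) {m m' : ℝ} (hm : 0 ≤ m) (hmm' : m ≤ m') :
    ∫ V, Ψ V * ∏ y ∈ T, (if y ∈ LF V then m else 1) ∂(Measure.pi fun _ : Edge 4 M => haarProbability G) ≤
      ∫ V, Ψ V * ∏ y ∈ T, (if y ∈ LF V then m' else 1) ∂Measure.pi fun _ : Edge 4 M => haarProbability G :=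
  integral_mono (integrable_weight_mul_prod hΨm hΨ0 hΨ1 hLFm hm)
    (integrable_weight_mul_prod hΨm hΨ0 hΨ1 hLFm (hm.trans hmm'))
    fun V => mul_le_mul_of_nonneg_left (prod_ite_mem_mono T LF hm hmm' V) (hΨ0 V).le

end Products

end SignedFormat

/-! ### Registered sub-goal carried by this file -/

/-- **Registered sub-goal of Stub N3 carried by this support file** — one-link right
multiplication `V ↦ V[e₀ ↦ V e₀ · a]` preserves the product Haar measure on `SU(3)` block
configurations (`SignedFormat.measurePreserving_linkUpdate`: right invariance of Haar on the factor
`e₀`, identity on the others). [folklore] -/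
theorem stub_formatBallClustering_linkUpdate : ∀ (M : ℕ) [NeZero M] (e₀ : Edge 4 M) (a : ↥(Matrix.specialUnitaryGroup (Fin 3) ℂ)), MeasurePreserving (fun V : GaugeConfig 4 M ↥(Matrix.specialUnitaryGroup (Fin 3) ℂ) => Function.update V e₀ (V e₀ * a)) (Measure.pi fun _ : Edge 4 M => haarProbability ↥(Matrix.specialUnitaryGroup (Fin 3) ℂ)) (Measure.pi fun _ : Edge 4 M => haarProbability ↥(Matrix.specialUnitaryGroup (Fin 3) ℂ)) :=
  fun _ _ e₀ a => SignedFormat.measurePreserving_linkUpdate e₀ a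

end Summit.QuantumFields.QCD.Cruxes.RobustYangMillsRG.Birth
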